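import Summits.QuantumFields.BalabanUV.T4Continuum.Support.NE7ConvOneStepWeighted
import Summits.QuantumFields.BalabanUV.T4Continuum.Support.NE7ConvOneStepSU3
import HarnessLib

/-!
# NE7ConvOneStepWeightedClass — ONE-STEP ⇐ CRIT-ONE-STEP ∧ REP with REP's normal letters in the η-WEIGHTED ENERGY CURRENCY (F9), over the CLASS
# `sfClass d L N ε`, with criticality on `ker levelQ'` (F10 §1), and the `d = 4`, `L = 2`, SU(2) ∕ SU(3) ENDs in that currency

Cell `pub-balaban`, rung (B)+1 sub-cell t4, lineage `b2b-balaban-t4-ne7-p1`, generation 67 (CRUX PROVER NE7 #1); hunt (h11) «CURRENCY OF THE NORMAL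
LETTERS», memo `t4/b2b-balaban-t4-ne7-p1-g67/HUNT-H11-NORMAL-CURRENCY.md` §1–§2.  File F15 (over F9 `NE7ConvOneStepWeighted` p351277 and F10
`NE7CriticalSliceAdapter` p351593; the SU(2) ∕ SU(3) data of F12 ∕ F13 by name).

WHY THIS FILE (honest repair of the record).  The ENDs F10–F13 (`oneStep_of_kerCritical_rep_class`, `…_lines`, `oneStep_SU2_of_kerCritical_rep`,
`oneStep_SU3_of_kerCritical_rep`) state REP's two normal letters in the `dirSq` currency of F4: `dirSq X_N ≤ θ·dirSq X`,
`Σ‖d_{U♯}X_N‖ ≤ C_N·dirSq X`, under a line that needs `16d·θ < (L^{k+1})^{−2}∕(4·CP)`, i.e. `θ = O(η²)`, `η = L^{−(k+1)}`.  The normal part of the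
chord `X` between two ADMISSIBLE configurations is the second-order correction `Q′X = −R₂(X)` of the constraint; for a chord of sup-size
`α = c·ε·η` (the [Balaban1985Variational] Prop. 2 TYPE size) its relative `dirSq`-size is `θ ≈ (c·ε)²∕36` — k-FREE BUT NOT `O(η²)` (memo H11 §1,
order-of-magnitude count, OURS, not a theorem) — so the `dirSq` line cannot be met at levels with `η² < 64d·CP·θ`, and ONE-STEP needs every level.
In the WEIGHTED currency of F9 (`‖Y‖_w² = curlSq U♯ Y + (L^{k+1})^{−2}·dirSq Y`, row NE3's `energyNormW`) the letters `‖X_N‖_w ≤ ν‖X‖_w`,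
`a·Σ‖d_{U♯}X_N‖ ≤ κ₁‖X‖_w²` are met k-UNIFORMLY (`ν² ≈ c²ε²∕5`, `κ₁ ≈ 2ε∕L²`) PROVIDED `X_N` is the SMOOTH (minimal-energy, H-type) lift of
`−R₂(X)` and NOT the blockwise spread lift (whose face jumps give `ν² ≈ 8d²c²ε²·L^{k+1}∕L²`, growing in `k` — memo H11 §2).  Hence the instantiable
form of «ONE-STEP ⇐ CRIT ∧ REP» is the weighted one, typed here; F10–F13 stay true (implications) but are superseded as ENDs.

WHAT ([folklore] composition; 0 def, 0 sorry; four theorems).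
§1 `isMinimiser_of_kerCritical_repW_class` — CONV-ONE-STEP over `sfClass d L N ε` at level `k+1`: `U♯` admissible, CRITICAL on the `𝔲(N)` torus fields
   in `ker (levelQ' L N k U♯)` (F10 §1 turns it into criticality on `T_♮(U♯) = frameFreeBlockLandauW L N (k+1) U♯` given `LevelSmall`), (P♮)_W classwide
   with constant `CP`, and every admissible `U′` REPRESENTED over `U♯` with the WEIGHTED normal letters and F9's line at `a = ε(L^{k+1})^{−2}` ⟹
   `IsMinimiser`.  F9 `isMinimiser_of_critical_rep_weighted` BY NAME.
§2 `oneStep_of_kerCritical_repW_class` — the `hstep` binder of `NE7InteriorInduction.interior_exists_all_levels` from «CRIT-ONE-STEP on `ker levelQ'`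
   ∧ REP (weighted)» at every level, given (P♮)_W and the `LevelSmall` family.
§3 `oneStep_SU2_of_kerCritical_repW` ∕ `oneStep_SU3_of_kerCritical_repW` — `d = 4`, `L = 2`, `card n = 2` resp. `3`, `0 < ε ≤ 10⁻⁵³`: (P♮)_W and the
   level family DISCHARGED by row NE3's `classSlicePoincare_SU2'` ∕ F13's `classSlicePoincare_SU3` and F12's `levelSmall_all_d4_L2`; constant of record
   `CP = CPLine 4 2 c 10⁻¹⁷ 10⁻⁵³ + 1` (`c = 2, 3`).  SO, FOR THE PROGRAMME's CASE AND IN THE INSTANTIABLE CURRENCY: ONE-STEP ⇐ [kernel] CRIT-ONE-STEP ∧ REP_w.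
THE LINE AT THE NATURAL SCALES (display; k-free): with `a = ε·η²`, `α = c·ε·η`, `η = L^{−(k+1)}` it reads
`2κ₁ ≤ ((m_E∕2 − 576d(e^{cεη} − 1)²η^{−2})∕card n − 28d(ε + 7c²ε²))`, `m_E = (1∕2 − ν²)∕(2(1+CP)) − ν²`, every term `O(1)`, `O(ε)` or `O(ε²)`.

HONEST FRAMING (page 1).  Composition over the two HYPOTHESES CRIT (= [Balaban1985Variational] Thm 1 + Prop. 7 + Sect. F's printed content, local
reading; by F8 ≡ the Euler–Lagrange system with a coarse multiplier) and REP_w (= B8 Thm 2 ∕ B11 Prop. 2 TYPE gauge-fixed chord with `‖X‖_∞ ≤ α` whose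
tangent part lies in `T_♮(U♯)`, plus the weighted normal sizes of the SMOOTH lift — neither proved here nor in the tree); NOT ONE-STEP, NOT NE7; spine
0∕9; finite T⁴ rung (B)+1 — NOT infinite volume, NOT mass gap, NOT Clay.  Continuum YM on T⁴ ⇐ BetaPertH ∧ nine spine estimates (0/9 proved); BetaPertH ⇐
(D1) ∧ (D4) ∧ CAP+tail; G-an2-4 gates asym, D1 and NE2/3/4.
-/

set_option autoImplicit false

open scoped BigOperators Matrix.Norms.L2Operator
open NormedSpace Finset Set

namespace Summit.QuantumFields.BalabanUV.T4Continuum.NE7ConvOneStepWeightedClass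

open Literature.MathematicalPhysics.QuantumFieldTheory.Balaban1983to89
open B7Prop1Explicit B7Prop2Explicit MatrixLog UnitaryModel
open T4AveragingDeficitWall (IsUnitaryCfg IsSkewDir SmallField fineAction vary curl curlSq dirSq)
open T4AveragingDeficitWallBoundary (IsPeriodicCfg periodBox)
open AveragingDeficitPeriodicCounting (IsPeriodicDir)
open AveragingDeficitTorusChart (TDir extDir)
open AveragingDeficitMultiLevelPrep (tower LevelSmall levelQ')
open AveragingDeficitMultiLevelBridge (tower_eq)
open MinimalActionLevels (levelAction perWin)
open MinimalActionSandwich (IsMinimiser admissible)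
open MinimalActionRate (sfClass)
open NE3HessForm (dAction)
open NE3SlicePoincareShape (SlicePoincare slicePoincare_mono)
open NE3FrameFreeSliceW (frameFreeBlockLandauW)
open NE3EnergyWeightedShapes (energyNormW)
open NE3SlicePoincareBudgetLine (CPLine)
open NE3ClassRadiusFamily (classSlicePoincare_SU2' CPLine_nonneg CPLine_nonneg_d4_L2)
open NE7ConvOneStepWeighted (isMinimiser_of_critical_rep_weighted)
open NE7CriticalSliceAdapter (dAction_eq_zero_on_slice_of_ker)
open NE7ConvOneStepSU2 (levelSmall_all_d4_L2)
open NE7ConvOneStepSU3 (classSlicePoincare_SU3)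

noncomputable section

variable {d : ℕ} {n : Type*} [Fintype n] [DecidableEq n]

/-! ## §1 CONV-ONE-STEP over the class, criticality on `ker levelQ'`, REP in the weighted currency -/

/-- **CONV-ONE-STEP ON THE CLASS FROM CRITICALITY ON `ker levelQ'` AND REP WITH WEIGHTED NORMAL LETTERS** (F9 `isMinimiser_of_critical_rep_weighted`
at `a = ε(L^{k+1})^{−2}`, `T = T_♮(U♯)`, `C = CP`, with F10 §1 `dAction_eq_zero_on_slice_of_ker`; `L, N ≥ 1`, `ε ≥ 0`, `0 < CP`,
`LevelSmall d L k (ε(L^{k+1})^{−2})`).  See the module docstring, §1. [folklore] -/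
theorem isMinimiser_of_kerCritical_repW_class [Nonempty n] {L N k : ℕ} [NeZero L] [NeZero N] (hL : 1 ≤ L) (hN : 1 ≤ N) {ε CP : ℝ}
    (hε : 0 ≤ ε) (hCP : 0 < CP) (hls : LevelSmall d L k (ε / ((L : ℝ) ^ (k + 1)) ^ 2))
    (hP : ∀ (j : ℕ) (W : Site d → Fin d → (Matrix n n ℂ)ˣ), W ∈ sfClass d L N ε (j + 1) →
      SlicePoincare L (j + 1) W (frameFreeBlockLandauW L N (j + 1) W) CP (periodBox (d := d) (N * L ^ (j + 1))))
    {V Us : Site d → Fin d → (Matrix n n ℂ)ˣ} (hmem : Us ∈ admissible (sfClass d L N ε) L (k + 1) V)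
    (hcritK : ∀ Φ : TDir d n (L * tower L N k), (∀ r κ, Φ r κ ∈ skewAdjoint (Matrix n n ℂ)) →
      levelQ' L N k Us Φ = 0 → dAction Us (extDir (L * tower L N k) Φ) (perWin d (N * L ^ (k + 1))) = 0)
    (hrep : ∀ U' ∈ admissible (sfClass d L N ε) L (k + 1) V, ∃ (X XT XN : Site d → Fin d → Matrix n n ℂ) (α ν κ₁ : ℝ),
      IsSkewDir X ∧ IsPeriodicDir X ((N * L ^ (k + 1) : ℕ) : ℤ) ∧ 0 ≤ α ∧ (∀ x μ, ‖X x μ‖ ≤ α) ∧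
      levelAction d L N (k + 1) (vary Us X 1) ≤ levelAction d L N (k + 1) U' ∧
      SmallField (vary Us X 1) (ε / ((L : ℝ) ^ (k + 1)) ^ 2) ∧
      X = XT + XN ∧ XT ∈ frameFreeBlockLandauW (d := d) (n := n) L N (k + 1) Us ∧ IsSkewDir XN ∧ 0 ≤ ν ∧
      energyNormW L (k + 1) Us XN (periodBox (d := d) (N * L ^ (k + 1)))
        ≤ ν * energyNormW L (k + 1) Us X (periodBox (d := d) (N * L ^ (k + 1))) ∧
      ε / ((L : ℝ) ^ (k + 1)) ^ 2 * (∑ p ∈ perWin d (N * L ^ (k + 1)), ‖curl Us XN p‖)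
        ≤ κ₁ * energyNormW L (k + 1) Us X (periodBox (d := d) (N * L ^ (k + 1))) ^ 2 ∧
      2 * κ₁ ≤ ((((1 / 2 - ν ^ 2) / (2 * (1 + CP)) - ν ^ 2) / 2
          - 576 * d * (Real.exp α - 1) ^ 2 * ((L : ℝ) ^ (k + 1)) ^ 2) / (Fintype.card n : ℝ)
          - 28 * d * (ε / ((L : ℝ) ^ (k + 1)) ^ 2 + 7 * α ^ 2) * ((L : ℝ) ^ (k + 1)) ^ 2)) :
    IsMinimiser d (sfClass d L N ε) L N (k + 1) V Us := by
  have ha : 0 ≤ ε / ((L : ℝ) ^ (k + 1)) ^ 2 := by positivity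
  have hUsP : IsPeriodicCfg Us ((L : ℤ) * (tower L N k : ℕ)) := by
    have e : ((N * L ^ (k + 1) : ℕ) : ℤ) = (L : ℤ) * (tower L N k : ℕ) := by rw [tower_eq]; push_cast; ring
    rw [← e]; exact hmem.1.2.1
  have hcrit := dAction_eq_zero_on_slice_of_ker hL hmem.1.1 hUsP ha hls hmem.1.2.2 (perWin d (N * L ^ (k + 1))) hcritK
  exact isMinimiser_of_critical_rep_weighted hL hN hmem hmem.1.1 ha hmem.1.2.2 hCP (hP k Us hmem.1) hcrit hrep

/-! ## §2 ONE-STEP from «CRIT-ONE-STEP on `ker levelQ'` + REP (weighted)» at every level -/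

/-- **ONE-STEP FROM «CRIT-ONE-STEP ON `ker levelQ'` + REP WITH WEIGHTED NORMAL LETTERS» GIVEN (P♮)_W AND THE LEVEL SMALLNESS FAMILY** (the `hstep`
binder of `NE7InteriorInduction.interior_exists_all_levels`).  See the module docstring, §2. [folklore] -/
theorem oneStep_of_kerCritical_repW_class [Nonempty n] {L N : ℕ} [NeZero L] [NeZero N] (hL : 1 ≤ L) (hN : 1 ≤ N) {ε δ CP : ℝ}
    (hε : 0 ≤ ε) (hCP : 0 < CP) (hls : ∀ k : ℕ, LevelSmall d L k (ε / ((L : ℝ) ^ (k + 1)) ^ 2))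
    (hP : ∀ (j : ℕ) (W : Site d → Fin d → (Matrix n n ℂ)ˣ), W ∈ sfClass d L N ε (j + 1) →
      SlicePoincare L (j + 1) W (frameFreeBlockLandauW L N (j + 1) W) CP (periodBox (d := d) (N * L ^ (j + 1))))
    {V : Site d → Fin d → (Matrix n n ℂ)ˣ}
    (hcrit : ∀ (k : ℕ) (U₀ : Site d → Fin d → (Matrix n n ℂ)ˣ), U₀ ∈ admissible (sfClass d L N ε) L (k + 1) V →
      SmallField U₀ (δ / ((L : ℝ) ^ k) ^ 2) →
      ∃ Us : Site d → Fin d → (Matrix n n ℂ)ˣ, Us ∈ admissible (sfClass d L N ε) L (k + 1) V ∧ SmallField Us (δ / ((L : ℝ) ^ (k + 1)) ^ 2) ∧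
        (∀ Φ : TDir d n (L * tower L N k), (∀ r κ, Φ r κ ∈ skewAdjoint (Matrix n n ℂ)) →
          levelQ' L N k Us Φ = 0 → dAction Us (extDir (L * tower L N k) Φ) (perWin d (N * L ^ (k + 1))) = 0) ∧
        ∀ U' ∈ admissible (sfClass d L N ε) L (k + 1) V, ∃ (X XT XN : Site d → Fin d → Matrix n n ℂ) (α ν κ₁ : ℝ),
          IsSkewDir X ∧ IsPeriodicDir X ((N * L ^ (k + 1) : ℕ) : ℤ) ∧ 0 ≤ α ∧ (∀ x μ, ‖X x μ‖ ≤ α) ∧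
          levelAction d L N (k + 1) (vary Us X 1) ≤ levelAction d L N (k + 1) U' ∧
          SmallField (vary Us X 1) (ε / ((L : ℝ) ^ (k + 1)) ^ 2) ∧
          X = XT + XN ∧ XT ∈ frameFreeBlockLandauW (d := d) (n := n) L N (k + 1) Us ∧ IsSkewDir XN ∧ 0 ≤ ν ∧
          energyNormW L (k + 1) Us XN (periodBox (d := d) (N * L ^ (k + 1)))
            ≤ ν * energyNormW L (k + 1) Us X (periodBox (d := d) (N * L ^ (k + 1))) ∧
          ε / ((L : ℝ) ^ (k + 1)) ^ 2 * (∑ p ∈ perWin d (N * L ^ (k + 1)), ‖curl Us XN p‖)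
            ≤ κ₁ * energyNormW L (k + 1) Us X (periodBox (d := d) (N * L ^ (k + 1))) ^ 2 ∧
          2 * κ₁ ≤ ((((1 / 2 - ν ^ 2) / (2 * (1 + CP)) - ν ^ 2) / 2
              - 576 * d * (Real.exp α - 1) ^ 2 * ((L : ℝ) ^ (k + 1)) ^ 2) / (Fintype.card n : ℝ)
              - 28 * d * (ε / ((L : ℝ) ^ (k + 1)) ^ 2 + 7 * α ^ 2) * ((L : ℝ) ^ (k + 1)) ^ 2)) :
    ∀ (k : ℕ) (U₀ : Site d → Fin d → (Matrix n n ℂ)ˣ), U₀ ∈ admissible (sfClass d L N ε) L (k + 1) V →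
      SmallField U₀ (δ / ((L : ℝ) ^ k) ^ 2) →
      ∃ U, IsMinimiser d (sfClass d L N ε) L N (k + 1) V U ∧ SmallField U (δ / ((L : ℝ) ^ (k + 1)) ^ 2) := by
  intro k U₀ hU₀ hU₀a
  obtain ⟨Us, hmem, hUsδ, hcr, hrep⟩ := hcrit k U₀ hU₀ hU₀a
  exact ⟨Us, isMinimiser_of_kerCritical_repW_class hL hN hε hCP (hls k) hP hmem hcr hrep, hUsδ⟩

/-! ## §3 The programme's case `d = 4`, `L = 2`: SU(2) ∕ U(2) and SU(3) ∕ U(3) -/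

/-- **ONE-STEP AT `d = 4`, `L = 2`, SU(2)∕U(2) (`card n = 2`), `0 < ε ≤ 10⁻⁵³`, FROM CRIT-ONE-STEP ON `ker levelQ'` AND REP WITH WEIGHTED NORMAL LETTERS
ONLY** — (P♮)_W by `NE3ClassRadiusFamily.classSlicePoincare_SU2'`, the level family by `NE7ConvOneStepSU2.levelSmall_all_d4_L2`, constant of record
`CP = CPLine 4 2 2 10⁻¹⁷ 10⁻⁵³ + 1`.  See the module docstring, §3. [folklore] -/
theorem oneStep_SU2_of_kerCritical_repW [Nonempty n] (hn : Fintype.card n = 2) {N : ℕ} [NeZero N] (hN : 1 ≤ N) {ε δ : ℝ} (hε : 0 < ε)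
    (hε' : ε ≤ 1 / 10 ^ 53) {V : Site 4 → Fin 4 → (Matrix n n ℂ)ˣ}
    (hcrit : ∀ (k : ℕ) (U₀ : Site 4 → Fin 4 → (Matrix n n ℂ)ˣ), U₀ ∈ admissible (sfClass 4 2 N ε) 2 (k + 1) V →
      SmallField U₀ (δ / (((2 : ℕ) : ℝ) ^ k) ^ 2) →
      ∃ Us : Site 4 → Fin 4 → (Matrix n n ℂ)ˣ, Us ∈ admissible (sfClass 4 2 N ε) 2 (k + 1) V ∧
        SmallField Us (δ / (((2 : ℕ) : ℝ) ^ (k + 1)) ^ 2) ∧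
        (∀ Φ : TDir 4 n (2 * tower 2 N k), (∀ r κ, Φ r κ ∈ skewAdjoint (Matrix n n ℂ)) →
          levelQ' 2 N k Us Φ = 0 → dAction Us (extDir (2 * tower 2 N k) Φ) (perWin 4 (N * 2 ^ (k + 1))) = 0) ∧
        ∀ U' ∈ admissible (sfClass 4 2 N ε) 2 (k + 1) V, ∃ (X XT XN : Site 4 → Fin 4 → Matrix n n ℂ) (α ν κ₁ : ℝ),
          IsSkewDir X ∧ IsPeriodicDir X ((N * 2 ^ (k + 1) : ℕ) : ℤ) ∧ 0 ≤ α ∧ (∀ x μ, ‖X x μ‖ ≤ α) ∧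
          levelAction 4 2 N (k + 1) (vary Us X 1) ≤ levelAction 4 2 N (k + 1) U' ∧
          SmallField (vary Us X 1) (ε / (((2 : ℕ) : ℝ) ^ (k + 1)) ^ 2) ∧
          X = XT + XN ∧ XT ∈ frameFreeBlockLandauW (d := 4) (n := n) 2 N (k + 1) Us ∧ IsSkewDir XN ∧ 0 ≤ ν ∧
          energyNormW 2 (k + 1) Us XN (periodBox (d := 4) (N * 2 ^ (k + 1)))
            ≤ ν * energyNormW 2 (k + 1) Us X (periodBox (d := 4) (N * 2 ^ (k + 1))) ∧
          ε / (((2 : ℕ) : ℝ) ^ (k + 1)) ^ 2 * (∑ p ∈ perWin 4 (N * 2 ^ (k + 1)), ‖curl Us XN p‖)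
            ≤ κ₁ * energyNormW 2 (k + 1) Us X (periodBox (d := 4) (N * 2 ^ (k + 1))) ^ 2 ∧
          2 * κ₁ ≤ ((((1 / 2 - ν ^ 2) / (2 * (1 + (CPLine 4 2 2 (1 / 10 ^ 17) (1 / 10 ^ 53) + 1))) - ν ^ 2) / 2
              - 576 * (4 : ℕ) * (Real.exp α - 1) ^ 2 * ((((2 : ℕ) : ℝ)) ^ (k + 1)) ^ 2) / (Fintype.card n : ℝ)
              - 28 * (4 : ℕ) * (ε / (((2 : ℕ) : ℝ) ^ (k + 1)) ^ 2 + 7 * α ^ 2) * ((((2 : ℕ) : ℝ)) ^ (k + 1)) ^ 2)) :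
    ∀ (k : ℕ) (U₀ : Site 4 → Fin 4 → (Matrix n n ℂ)ˣ), U₀ ∈ admissible (sfClass 4 2 N ε) 2 (k + 1) V →
      SmallField U₀ (δ / (((2 : ℕ) : ℝ) ^ k) ^ 2) →
      ∃ U, IsMinimiser 4 (sfClass 4 2 N ε) 2 N (k + 1) V U ∧ SmallField U (δ / (((2 : ℕ) : ℝ) ^ (k + 1)) ^ 2) := by
  have hP0 := classSlicePoincare_SU2' (n := n) hn hN hε hε'
  have hCP : 0 < CPLine 4 2 2 (1 / 10 ^ 17) (1 / 10 ^ 53) + 1 := by linarith [CPLine_nonneg_d4_L2]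
  have hP : ∀ (j : ℕ) (W : Site 4 → Fin 4 → (Matrix n n ℂ)ˣ), W ∈ sfClass 4 2 N ε (j + 1) →
      SlicePoincare 2 (j + 1) W (frameFreeBlockLandauW 2 N (j + 1) W) (CPLine 4 2 2 (1 / 10 ^ 17) (1 / 10 ^ 53) + 1)
        (periodBox (d := 4) (N * 2 ^ (j + 1))) :=
    fun j W hW => slicePoincare_mono (hP0 j W hW) (by linarith)
  have hls := levelSmall_all_d4_L2 hε.le (hε'.trans (by norm_num))
  exact oneStep_of_kerCritical_repW_class (d := 4) (by norm_num) hN hε.le hCP hls hP hcrit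

/-- **ONE-STEP AT `d = 4`, `L = 2`, SU(3)∕U(3) (`card n = 3`), `0 < ε ≤ 10⁻⁵³`, FROM CRIT-ONE-STEP ON `ker levelQ'` AND REP WITH WEIGHTED NORMAL LETTERS
ONLY** — (P♮)_W by F13's `classSlicePoincare_SU3`, constant of record `CP = CPLine 4 2 3 10⁻¹⁷ 10⁻⁵³ + 1`.  See the module docstring, §3. [folklore] -/
theorem oneStep_SU3_of_kerCritical_repW [Nonempty n] (hn : Fintype.card n = 3) {N : ℕ} [NeZero N] (hN : 1 ≤ N) {ε δ : ℝ} (hε : 0 < ε)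
    (hε' : ε ≤ 1 / 10 ^ 53) {V : Site 4 → Fin 4 → (Matrix n n ℂ)ˣ}
    (hcrit : ∀ (k : ℕ) (U₀ : Site 4 → Fin 4 → (Matrix n n ℂ)ˣ), U₀ ∈ admissible (sfClass 4 2 N ε) 2 (k + 1) V →
      SmallField U₀ (δ / (((2 : ℕ) : ℝ) ^ k) ^ 2) →
      ∃ Us : Site 4 → Fin 4 → (Matrix n n ℂ)ˣ, Us ∈ admissible (sfClass 4 2 N ε) 2 (k + 1) V ∧
        SmallField Us (δ / (((2 : ℕ) : ℝ) ^ (k + 1)) ^ 2) ∧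
        (∀ Φ : TDir 4 n (2 * tower 2 N k), (∀ r κ, Φ r κ ∈ skewAdjoint (Matrix n n ℂ)) →
          levelQ' 2 N k Us Φ = 0 → dAction Us (extDir (2 * tower 2 N k) Φ) (perWin 4 (N * 2 ^ (k + 1))) = 0) ∧
        ∀ U' ∈ admissible (sfClass 4 2 N ε) 2 (k + 1) V, ∃ (X XT XN : Site 4 → Fin 4 → Matrix n n ℂ) (α ν κ₁ : ℝ),
          IsSkewDir X ∧ IsPeriodicDir X ((N * 2 ^ (k + 1) : ℕ) : ℤ) ∧ 0 ≤ α ∧ (∀ x μ, ‖X x μ‖ ≤ α) ∧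
          levelAction 4 2 N (k + 1) (vary Us X 1) ≤ levelAction 4 2 N (k + 1) U' ∧
          SmallField (vary Us X 1) (ε / (((2 : ℕ) : ℝ) ^ (k + 1)) ^ 2) ∧
          X = XT + XN ∧ XT ∈ frameFreeBlockLandauW (d := 4) (n := n) 2 N (k + 1) Us ∧ IsSkewDir XN ∧ 0 ≤ ν ∧
          energyNormW 2 (k + 1) Us XN (periodBox (d := 4) (N * 2 ^ (k + 1)))
            ≤ ν * energyNormW 2 (k + 1) Us X (periodBox (d := 4) (N * 2 ^ (k + 1))) ∧
          ε / (((2 : ℕ) : ℝ) ^ (k + 1)) ^ 2 * (∑ p ∈ perWin 4 (N * 2 ^ (k + 1)), ‖curl Us XN p‖)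
            ≤ κ₁ * energyNormW 2 (k + 1) Us X (periodBox (d := 4) (N * 2 ^ (k + 1))) ^ 2 ∧
          2 * κ₁ ≤ ((((1 / 2 - ν ^ 2) / (2 * (1 + (CPLine 4 2 3 (1 / 10 ^ 17) (1 / 10 ^ 53) + 1))) - ν ^ 2) / 2
              - 576 * (4 : ℕ) * (Real.exp α - 1) ^ 2 * ((((2 : ℕ) : ℝ)) ^ (k + 1)) ^ 2) / (Fintype.card n : ℝ)
              - 28 * (4 : ℕ) * (ε / (((2 : ℕ) : ℝ) ^ (k + 1)) ^ 2 + 7 * α ^ 2) * ((((2 : ℕ) : ℝ)) ^ (k + 1)) ^ 2)) :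
    ∀ (k : ℕ) (U₀ : Site 4 → Fin 4 → (Matrix n n ℂ)ˣ), U₀ ∈ admissible (sfClass 4 2 N ε) 2 (k + 1) V →
      SmallField U₀ (δ / (((2 : ℕ) : ℝ) ^ k) ^ 2) →
      ∃ U, IsMinimiser 4 (sfClass 4 2 N ε) 2 N (k + 1) V U ∧ SmallField U (δ / (((2 : ℕ) : ℝ) ^ (k + 1)) ^ 2) := by
  have hP0 := classSlicePoincare_SU3 (n := n) hn hN hε hε'
  have hCP0 : 0 ≤ CPLine 4 2 3 (1 / 10 ^ 17) (1 / 10 ^ 53) := CPLine_nonneg (by norm_num) (by norm_num) (by norm_num) (by norm_num)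
  have hCP : 0 < CPLine 4 2 3 (1 / 10 ^ 17) (1 / 10 ^ 53) + 1 := by linarith
  have hP : ∀ (j : ℕ) (W : Site 4 → Fin 4 → (Matrix n n ℂ)ˣ), W ∈ sfClass 4 2 N ε (j + 1) →
      SlicePoincare 2 (j + 1) W (frameFreeBlockLandauW 2 N (j + 1) W) (CPLine 4 2 3 (1 / 10 ^ 17) (1 / 10 ^ 53) + 1)
        (periodBox (d := 4) (N * 2 ^ (j + 1))) :=
    fun j W hW => slicePoincare_mono (hP0 j W hW) (by linarith)
  have hls := levelSmall_all_d4_L2 hε.le (hε'.trans (by norm_num))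
  exact oneStep_of_kerCritical_repW_class (d := 4) (by norm_num) hN hε.le hCP hls hP hcrit

end

end Summit.QuantumFields.BalabanUV.T4Continuum.NE7ConvOneStepWeightedClass
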